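import Literature.Computability.QuantumComplexity.PauliExpansion
import HarnessLib

/-!
# Product states on a qubit register: `(⊗ᵢ Aᵢ)(⊗ᵢ ψᵢ) = ⊗ᵢ Aᵢψᵢ` and `⟨⊗ψ | ⊗φ⟩ = ∏ᵢ ⟨ψᵢ|φᵢ⟩`

Textbook material: M. A. Nielsen and I. L. Chuang, *Quantum Computation and Quantum Information*
(10th anniversary ed., CUP 2010), §2.1.7 "Tensor products", eq. (2.45)
`(A ⊗ B)(|v⟩ ⊗ |w⟩) ≡ A|v⟩ ⊗ B|w⟩`, eq. (2.49) (the inner product on `V ⊗ W`: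
`(Σ aᵢ|vᵢ⟩⊗|wᵢ⟩, Σ bⱼ|v'ⱼ⟩⊗|w'ⱼ⟩) ≡ Σ aᵢ* bⱼ ⟨vᵢ|v'ⱼ⟩⟨wᵢ|w'ⱼ⟩`) and eq. (2.50) (the Kronecker-product
matrix representation), here for finitely many tensor factors indexed by the wires `ι` of a register
`ι → Bool`, on the tree's `tensorAll` (entry `(x, y) ↦ ∏ᵢ Aᵢ (xᵢ) (yᵢ)`, `PauliExpansion.lean`).

Consequence recorded for the lane's certificates (pub-qadeq — instance-level adjudication of specific
advantage claims; no claim about BQP vs BPP or the summit): the expectation value of a tensor-product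
observable in a product state factorises, `⟨⊗ψ| ⊗ᵢAᵢ |⊗ψ⟩ = ∏ᵢ ⟨ψᵢ|Aᵢ|ψᵢ⟩`, so a "quantum layer" made of
independent single-qubit wires (CLAIMS row A-1457: `H`–`R_y` wires read out in `Z`) has per-wire closed forms
(`SingleQubitRotations.expect_Z_rotY_hadamard_ket0`; the expectation `star ψ ⬝ᵥ (A *ᵥ ψ)` below is
`SingleQubitRotations.expect A ψ` by `rfl` — this file imports only `PauliExpansion`). Everything is proved; no named facts.
-/

noncomputable section

open Matrix

namespace Literature.Computability.QuantumComplexity.ProductState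

open Literature.Computability.QuantumComplexity

variable {ι : Type*} [Fintype ι] [DecidableEq ι]

/-- The product state `⊗ᵢ ψᵢ` of one-qubit vectors on the register `ι → Bool`: amplitude
`x ↦ ∏ᵢ ψᵢ(xᵢ)` (the Kronecker product of the column vectors). [cite: NielsenChuang2010, §2.1.7 eq. (2.50)–(2.51)] -/
def productState (ψ : ι → Bool → ℂ) : (ι → Bool) → ℂ := fun x => ∏ i, ψ i (x i)

omit [DecidableEq ι] in
/-- Amplitudes of a product state. [cite: NielsenChuang2010, §2.1.7 eq. (2.51)] -/
@[simp] theorem productState_apply (ψ : ι → Bool → ℂ) (x : ι → Bool) :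
    productState ψ x = ∏ i, ψ i (x i) := rfl

/-- `(⊗ᵢ Aᵢ)(⊗ᵢ ψᵢ) = ⊗ᵢ (Aᵢ ψᵢ)`. [cite: NielsenChuang2010, §2.1.7 eq. (2.45)] -/
theorem tensorAll_mulVec_productState (A : ι → Matrix Bool Bool ℂ) (ψ : ι → Bool → ℂ) :
    tensorAll A *ᵥ productState ψ = productState fun i => A i *ᵥ ψ i := by
  funext x
  simp only [mulVec, dotProduct, tensorAll_apply, productState_apply]
  rw [Fintype.prod_sum (fun i b => A i (x i) b * ψ i b)]
  refine Finset.sum_congr rfl fun y _ => ?_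
  rw [← Finset.prod_mul_distrib]

/-- `⟨⊗ᵢ ψᵢ | ⊗ᵢ φᵢ⟩ = ∏ᵢ ⟨ψᵢ|φᵢ⟩` — the inner product on the tensor product space.
[cite: NielsenChuang2010, §2.1.7 eq. (2.49)] -/
theorem star_productState_dotProduct_productState (ψ φ : ι → Bool → ℂ) :
    star (productState ψ) ⬝ᵥ productState φ = ∏ i, (star (ψ i) ⬝ᵥ φ i) := by
  simp only [dotProduct, Pi.star_apply, productState_apply, star_prod]
  rw [Fintype.prod_sum (fun i b => star (ψ i b) * φ i b)]
  refine Finset.sum_congr rfl fun y _ => ?_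
  rw [← Finset.prod_mul_distrib]

/-- Expectation values of tensor-product observables factorise on product states:
`⟨⊗ψ| ⊗ᵢ Aᵢ |⊗ψ⟩ = ∏ᵢ ⟨ψᵢ|Aᵢ|ψᵢ⟩` (eqs. (2.45) and (2.49) combined).
[cite: NielsenChuang2010, §2.1.7 eqs. (2.45), (2.49)] -/
theorem expect_tensorAll_productState (A : ι → Matrix Bool Bool ℂ) (ψ : ι → Bool → ℂ) :
    star (productState ψ) ⬝ᵥ (tensorAll A *ᵥ productState ψ) = ∏ i, (star (ψ i) ⬝ᵥ (A i *ᵥ ψ i)) := by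
  rw [tensorAll_mulVec_productState, star_productState_dotProduct_productState]

/-- A product of normalised one-qubit states is normalised. [cite: NielsenChuang2010, §2.1.7 eq. (2.49)] -/
theorem star_productState_dotProduct_self_of_normalised (ψ : ι → Bool → ℂ)
    (hψ : ∀ i, star (ψ i) ⬝ᵥ ψ i = 1) : star (productState ψ) ⬝ᵥ productState ψ = 1 := by
  rw [star_productState_dotProduct_productState]
  exact Finset.prod_eq_one fun i _ => hψ i

/-- A local observable `Aᵢ ⊗ I_{rest}` on a product of normalised states has expectation `⟨ψᵢ|Aᵢ|ψᵢ⟩`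
(the single-wire read-out of a product "quantum layer"). [cite: NielsenChuang2010, §2.1.7 eqs. (2.45), (2.49)] -/
theorem expect_local_productState (i : ι) (Ai : Matrix Bool Bool ℂ) (ψ : ι → Bool → ℂ)
    (hψ : ∀ j, j ≠ i → star (ψ j) ⬝ᵥ ψ j = 1) :
    star (productState ψ) ⬝ᵥ (tensorAll (Function.update (fun _ => (1 : Matrix Bool Bool ℂ)) i Ai) *ᵥ productState ψ)
      = star (ψ i) ⬝ᵥ (Ai *ᵥ ψ i) := by
  rw [expect_tensorAll_productState, Finset.prod_eq_single i]
  · simp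
  · intro j _ hj
    rw [Function.update_of_ne hj]
    show star (ψ j) ⬝ᵥ ((1 : Matrix Bool Bool ℂ) *ᵥ ψ j) = 1
    rw [Matrix.one_mulVec]; exact hψ j hj
  · intro h; exact absurd (Finset.mem_univ i) h

end Literature.Computability.QuantumComplexity.ProductState
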